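import Mathlib
import Literature.Analysis.FluidPDE.GaussianVortexPlanar
import Literature.Analysis.FluidPDE.GaussianVortexPlanarProofs
import Literature.Analysis.FluidPDE.BiotSavart2DSymmetry
import Literature.Analysis.FluidPDE.WholeSpaceIBP
import Summits.AnomalousDissipation.AnomalousDissipation.Theorems.MarginalStabilityChainStretchedVortexRowsStubCoreRotationLocalSkew
import Summits.AnomalousDissipation.AnomalousDissipation.Theorems.MarginalStabilityChainStretchedVortexRowsStubBiotSavartFarField
import Summits.AnomalousDissipation.AnomalousDissipation.Theorems.MarginalStabilityChainStretchedVortexRowsStubCoreLEnergyGapTools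
import Summits.AnomalousDissipation.AnomalousDissipation.Theorems.MarginalStabilityChainStretchedVortexRowsStubCoreLAngularPairingTools
import Summits.AnomalousDissipation.AnomalousDissipation.Theorems.MarginalStabilityChainStretchedVortexRowsStubCoreInverseIntegrabilityClass
import HarnessLib

/-!
# Tools for the helper `coreInverse_integrability` toward stub `stub_coreInverse` of the line
# `braid-closed-large-circulation-gluing` (crux stmt-AnomalousDissipation-3009, `MarginalStabilityChain.StretchedVortexRows`)

Pointwise bounds of the pieces of the cut-off core operator `f = Lw + Sw − α(v^G·∇w + (K∗w)·∇G) − Λ_B w` in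
ground-state variables `w = G u`, `G = gaussVortexProfile = (4π)⁻¹e^{−|ξ|²/4}`, `u ∈ C²(ℝ²)` with
`|u|, ‖Du‖, ‖D²u‖ ≤ M` — everything is "continuous (or measurable) × polynomial × Gaussian":

* `|w| ≤ MG`, `‖∇w‖ ≤ M(1+|ξ|)G` (`∇w = G∇u + u∇G`, `∇G = −(ξ/2)G`), `∂_θw = G∂_θu` so `|∂_θw| ≤ M(1+|ξ|)G`,
  `|Δu| ≤ 2M` and `|Lw| = G|Δu − ½Du[ξ]| ≤ 3M(1+|ξ|)G` (`L = strainedVorticityOperator 0`, ground-state conjugation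
  `G⁻¹L(Gu) = Δu − ½Du[ξ]`, landed `inv_gaussVortexProfile_mul_strainedVorticityOperator_mul`) — bundled in the
  registered helper `coreInverse_groundState_bounds`;
* `‖v^G‖ = (8π)⁻¹φ(|ξ|²/4)|ξ| ≤ 1+|ξ|` (`0 < φ ≤ 1`), `‖∇G‖ ≤ (1+|ξ|)G`, `‖Bξ‖ = (b₁²+b₂²)^{1/2}|ξ|` for the strain
  field `Bξ = (b₁ξ₀+b₂ξ₁, b₂ξ₀−b₁ξ₁)`, boundedness of `χ, ∇χ` for `χ ∈ C¹_c`, and boundedness of the Biot–Savart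
  velocity `K∗g` of a continuous Gaussian-class density (landed far-field bound `‖K∗g‖ ≤ CA/(1+|ξ|)` of
  `…StubBiotSavartFarField`), its strong measurability (tree `stronglyMeasurable_biotSavart2D`);
* hence the strain term `Sw = χ⟪Bξ, ∇w⟫ + ⟪∇χ, Bξ⟫w` is of Gaussian class `(1+|ξ|)²G` and the background term
  `Λ_B w = ⟪K∗w, ∇w_B⟫ + ⟪K∗w_B, ∇w⟫` of class `(1+|ξ|)^{k+1}G` (`gaussClass_strainTerm`, `gaussClass_backgroundTerm`);
* continuity of `L_λ w` (`w ∈ C²`), of `v^G` and of the strain field; `(Dw[ξ^⊥])² ≤ (1+|ξ|²)‖∇w‖²`.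

References: Th. Gallay, C. E. Wayne, Comm. Math. Phys. 255 (2005) §4; Th. Gallay, C. E. Wayne, J. Math. Fluid Mech. 9
(2007), (1.3)–(1.9); Th. Gallay, Y. Maekawa, arXiv:1610.08384, §4.1.
-/

set_option linter.dupNamespace false

noncomputable section

open scoped RealInnerProductSpace Topology Laplacian
open MeasureTheory WithLp Function Filter Metric Set

namespace Summit.AnomalousDissipation.AnomalousDissipation.Theorems.MarginalStabilityChainStretchedVortexRows

open Literature.Analysis.FluidPDE Literature.Analysis.UnboundedOperators

/-! ### Pointwise dictionary: gradients, angular derivatives -/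

/-- `‖∇f‖ = ‖Df‖` (the gradient is the Riesz representative of the Fréchet derivative). [folklore] -/
theorem norm_gradient_eq_norm_fderiv (f : EuclideanSpace ℝ (Fin 2) → ℝ) (ξ : EuclideanSpace ℝ (Fin 2)) :
    ‖gradient f ξ‖ = ‖fderiv ℝ f ξ‖ := by
  rw [gradient, LinearIsometryEquiv.norm_map]

/-- `|Df(ξ)[ξ^⊥]| ≤ ‖∇f(ξ)‖ |ξ|`. [folklore] -/
theorem abs_fderiv_apply_perp_le (f : EuclideanSpace ℝ (Fin 2) → ℝ) (ξ : EuclideanSpace ℝ (Fin 2)) :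
    |fderiv ℝ f ξ (perp ξ)| ≤ ‖gradient f ξ‖ * ‖ξ‖ := by
  rw [← Real.norm_eq_abs, norm_gradient_eq_norm_fderiv, ← norm_perp ξ]
  exact ContinuousLinearMap.le_opNorm _ _

/-- `(Df(ξ)[ξ^⊥])² ≤ (1 + |ξ|²) ‖∇f(ξ)‖²`. [folklore] -/
theorem sq_fderiv_apply_perp_le (f : EuclideanSpace ℝ (Fin 2) → ℝ) (ξ : EuclideanSpace ℝ (Fin 2)) :
    (fderiv ℝ f ξ (perp ξ)) ^ 2 ≤ (1 + ‖ξ‖ ^ 2) * ‖gradient f ξ‖ ^ 2 := by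
  have h := abs_fderiv_apply_perp_le f ξ
  have h2 : (fderiv ℝ f ξ (perp ξ)) ^ 2 ≤ (‖gradient f ξ‖ * ‖ξ‖) ^ 2 := by
    rw [← sq_abs]
    exact pow_le_pow_left₀ (abs_nonneg _) h 2
  nlinarith [sq_nonneg ‖gradient f ξ‖]

/-- A Gaussian-class bound on `|w_B| + ‖∇w_B‖` bounds both pieces. [folklore] -/
theorem gaussClass_of_add_bound {wB : EuclideanSpace ℝ (Fin 2) → ℝ} {C_B : ℝ} {k : ℕ}
    (h : ∀ ξ, |wB ξ| + ‖gradient wB ξ‖ ≤ C_B * (1 + ‖ξ‖) ^ k * gaussVortexProfile ξ) :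
    (∀ ξ, |wB ξ| ≤ C_B * (1 + ‖ξ‖) ^ k * gaussVortexProfile ξ) ∧
      ∀ ξ, ‖gradient wB ξ‖ ≤ C_B * (1 + ‖ξ‖) ^ k * gaussVortexProfile ξ :=
  ⟨fun ξ => (le_add_of_nonneg_right (norm_nonneg _)).trans (h ξ),
    fun ξ => (le_add_of_nonneg_left (abs_nonneg _)).trans (h ξ)⟩

/-- A `C¹` function with compact support and its gradient are bounded. [folklore] -/
theorem exists_bound_of_hasCompactSupport {χ : EuclideanSpace ℝ (Fin 2) → ℝ} (hχ : ContDiff ℝ 1 χ)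
    (hχc : HasCompactSupport χ) :
    ∃ A : ℝ, (∀ ξ, |χ ξ| ≤ A * (1 + ‖ξ‖) ^ 0) ∧ ∀ ξ, ‖gradient χ ξ‖ ≤ A * (1 + ‖ξ‖) ^ 0 := by
  obtain ⟨A₁, h₁⟩ := hχ.continuous.bounded_above_of_compact_support hχc
  obtain ⟨A₂, h₂⟩ := (hχ.continuous_fderiv one_ne_zero).bounded_above_of_compact_support (hχc.fderiv (𝕜 := ℝ))
  refine ⟨max A₁ A₂, fun ξ => ?_, fun ξ => ?_⟩
  · rw [pow_zero, mul_one, ← Real.norm_eq_abs]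
    exact (h₁ ξ).trans (le_max_left _ _)
  · rw [pow_zero, mul_one, norm_gradient_eq_norm_fderiv]
    exact (h₂ ξ).trans (le_max_right _ _)

/-! ### The pieces of the core operator in ground-state variables `w = G u` -/

/-- The derivative of `w = G u`: `Dw = G Du + u DG`. [folklore] -/
theorem hasFDerivAt_gauss_mul {u : EuclideanSpace ℝ (Fin 2) → ℝ} (hu : Differentiable ℝ u)
    (ξ : EuclideanSpace ℝ (Fin 2)) :
    HasFDerivAt (fun η => gaussVortexProfile η * u η)
      (gaussVortexProfile ξ • fderiv ℝ u ξ + u ξ • fderiv ℝ gaussVortexProfile ξ) ξ :=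
  (((contDiff_gaussVortexProfile (n := 1)).differentiable one_ne_zero ξ).hasFDerivAt).fun_mul (hu ξ).hasFDerivAt

/-- The angular derivative of `w = G u`: `D(Gu)(ξ)[ξ^⊥] = G(ξ) Du(ξ)[ξ^⊥]` (`G` is radial). [folklore] -/
theorem fderiv_gauss_mul_perp {u : EuclideanSpace ℝ (Fin 2) → ℝ} (hu : Differentiable ℝ u)
    (ξ : EuclideanSpace ℝ (Fin 2)) :
    fderiv ℝ (fun η => gaussVortexProfile η * u η) ξ (perp ξ) = gaussVortexProfile ξ * fderiv ℝ u ξ (perp ξ) := by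
  rw [(hasFDerivAt_gauss_mul hu ξ).fderiv, _root_.add_apply, _root_.smul_apply, _root_.smul_apply, smul_eq_mul,
    smul_eq_mul, fderiv_gaussVortexProfile_apply, inner_self_perp]
  ring

section Pieces

variable {u : EuclideanSpace ℝ (Fin 2) → ℝ} {M : ℝ}
  (hM : ∀ ξ, |u ξ| ≤ M ∧ ‖fderiv ℝ u ξ‖ ≤ M ∧ ‖fderiv ℝ (fderiv ℝ u) ξ‖ ≤ M)
include hM

/-- `|w| = |G u| ≤ M G`. [folklore] -/
theorem abs_gauss_mul_le_of_coreBound (ξ : EuclideanSpace ℝ (Fin 2)) :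
    |gaussVortexProfile ξ * u ξ| ≤ M * (1 + ‖ξ‖) ^ 0 * gaussVortexProfile ξ := by
  rw [abs_mul, abs_of_pos (gaussVortexProfile_pos ξ), pow_zero, mul_one, mul_comm]
  exact mul_le_mul_of_nonneg_right (hM ξ).1 (gaussVortexProfile_pos ξ).le

/-- `‖∇w‖ ≤ M(1+|ξ|)G` for `w = G u` (`∇w = G∇u + u∇G`, `‖∇G‖ ≤ (G/2)|ξ|`). [folklore] -/
theorem norm_gradient_gauss_mul_le_of_coreBound (hu : Differentiable ℝ u) (ξ : EuclideanSpace ℝ (Fin 2)) :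
    ‖gradient (fun η => gaussVortexProfile η * u η) ξ‖ ≤ M * (1 + ‖ξ‖) ^ 1 * gaussVortexProfile ξ := by
  rw [norm_gradient_eq_norm_fderiv, (hasFDerivAt_gauss_mul hu ξ).fderiv, pow_one]
  have hG := gaussVortexProfile_pos ξ
  have h0 := (hM ξ).1
  have h1 := (hM ξ).2.1
  have h2 := norm_fderiv_gaussVortexProfile_le ξ
  have hM0 : 0 ≤ M := (abs_nonneg _).trans h0
  calc ‖gaussVortexProfile ξ • fderiv ℝ u ξ + u ξ • fderiv ℝ gaussVortexProfile ξ‖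
      ≤ ‖gaussVortexProfile ξ • fderiv ℝ u ξ‖ + ‖u ξ • fderiv ℝ gaussVortexProfile ξ‖ := norm_add_le _ _
    _ = gaussVortexProfile ξ * ‖fderiv ℝ u ξ‖ + |u ξ| * ‖fderiv ℝ gaussVortexProfile ξ‖ := by
        rw [norm_smul, norm_smul, Real.norm_of_nonneg hG.le, Real.norm_eq_abs]
    _ ≤ gaussVortexProfile ξ * M + M * (gaussVortexProfile ξ / 2 * ‖ξ‖) :=
        add_le_add (mul_le_mul_of_nonneg_left h1 hG.le) (mul_le_mul h0 h2 (norm_nonneg _) hM0)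
    _ ≤ M * (1 + ‖ξ‖) * gaussVortexProfile ξ := by
        nlinarith [mul_nonneg hM0 (mul_nonneg hG.le (norm_nonneg ξ))]

/-- `|∂_θw| ≤ M(1+|ξ|)G` for `w = G u` (`∂_θw = G ∂_θu`, `|∂_θu| ≤ M|ξ|`). [folklore] -/
theorem abs_angularDeriv_gauss_mul_le_of_coreBound (hu : Differentiable ℝ u) (ξ : EuclideanSpace ℝ (Fin 2)) :
    |fderiv ℝ (fun η => gaussVortexProfile η * u η) ξ (perp ξ)| ≤ M * (1 + ‖ξ‖) ^ 1 * gaussVortexProfile ξ := by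
  rw [fderiv_gauss_mul_perp hu ξ, abs_mul, abs_of_pos (gaussVortexProfile_pos ξ), pow_one]
  have h := norm_angularDeriv_le_of_coreBound hM ξ
  rw [Real.norm_eq_abs] at h
  have hG := gaussVortexProfile_pos ξ
  have hM0 : 0 ≤ M := (abs_nonneg _).trans (hM ξ).1
  calc gaussVortexProfile ξ * |fderiv ℝ u ξ (perp ξ)| ≤ gaussVortexProfile ξ * (M * ‖ξ‖) :=
        mul_le_mul_of_nonneg_left h hG.le
    _ ≤ M * (1 + ‖ξ‖) * gaussVortexProfile ξ := by nlinarith [mul_nonneg hM0 hG.le]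

/-- `|Δu| ≤ 2M` when `‖D²u‖ ≤ M` (`Δu = D²u[e₀,e₀] + D²u[e₁,e₁]`). [folklore] -/
theorem abs_laplacian_le_of_coreBound (ξ : EuclideanSpace ℝ (Fin 2)) : |Δ u ξ| ≤ 2 * M := by
  rw [InnerProductSpace.laplacian_eq_iteratedFDeriv_orthonormalBasis u (EuclideanSpace.basisFun (Fin 2) ℝ)]
  simp only [Fin.sum_univ_two, iteratedFDeriv_two_apply, EuclideanSpace.basisFun_apply, Matrix.cons_val_zero,
    Matrix.cons_val_one]
  have h : ∀ i : Fin 2,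
      |fderiv ℝ (fderiv ℝ u) ξ (EuclideanSpace.single i 1) (EuclideanSpace.single i 1)| ≤ M := by
    intro i
    have h1 := norm_fderiv_fderiv_apply_le_of_coreBound hM ξ (EuclideanSpace.single i 1)
      (EuclideanSpace.single i 1)
    rw [Real.norm_eq_abs] at h1
    simpa using h1
  exact (abs_add_le _ _).trans (by linarith [h 0, h 1])

/-- **`|Lw| ≤ 3M(1+|ξ|)G`** for `w = G u`: `L(Gu) = G(Δu − ½Du[ξ])` (ground-state conjugation of
`L = strainedVorticityOperator 0`, `inv_gaussVortexProfile_mul_strainedVorticityOperator_mul`). [folklore] -/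
theorem abs_strainedVorticityOperator_gauss_mul_le_of_coreBound (hu : ContDiff ℝ 2 u)
    (ξ : EuclideanSpace ℝ (Fin 2)) :
    |strainedVorticityOperator 0 (fun η => gaussVortexProfile η * u η) ξ| ≤
      3 * M * (1 + ‖ξ‖) ^ 1 * gaussVortexProfile ξ := by
  have hG := gaussVortexProfile_pos ξ
  have hconj := inv_gaussVortexProfile_mul_strainedVorticityOperator_mul hu ξ
  rw [inv_mul_eq_iff_eq_mul₀ hG.ne'] at hconj
  rw [hconj, abs_mul, abs_of_pos hG, pow_one]
  have hΔ := abs_laplacian_le_of_coreBound hM ξ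
  have hD : |fderiv ℝ u ξ ξ| ≤ M * ‖ξ‖ := by
    rw [← Real.norm_eq_abs]
    exact (ContinuousLinearMap.le_opNorm _ _).trans (mul_le_mul_of_nonneg_right (hM ξ).2.1 (norm_nonneg _))
  have hM0 : 0 ≤ M := (abs_nonneg _).trans (hM ξ).1
  have h1 : |Δ u ξ - 2⁻¹ * fderiv ℝ u ξ ξ| ≤ 2 * M + 2⁻¹ * (M * ‖ξ‖) := by
    refine (abs_sub _ _).trans (add_le_add hΔ ?_)
    rw [abs_mul, abs_of_pos (by norm_num : (0:ℝ) < 2⁻¹)]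
    exact mul_le_mul_of_nonneg_left hD (by norm_num)
  calc gaussVortexProfile ξ * |Δ u ξ - 2⁻¹ * fderiv ℝ u ξ ξ|
      ≤ gaussVortexProfile ξ * (2 * M + 2⁻¹ * (M * ‖ξ‖)) := mul_le_mul_of_nonneg_left h1 hG.le
    _ ≤ 3 * M * (1 + ‖ξ‖) * gaussVortexProfile ξ := by
        nlinarith [mul_nonneg hM0 hG.le, mul_nonneg (mul_nonneg hM0 hG.le) (norm_nonneg ξ)]

end Pieces

/-! ### Continuity, measurability and bounds of the coefficient fields -/

/-- `L_λ w` is continuous for `w ∈ C²`. [folklore] -/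
theorem continuous_strainedVorticityOperator {w : EuclideanSpace ℝ (Fin 2) → ℝ} (hw : ContDiff ℝ 2 w) (lam : ℝ) :
    Continuous (strainedVorticityOperator lam w) := by
  have hΔ : Continuous (Δ w) := continuous_laplacian hw
  have hD : Continuous (fderiv ℝ w) := hw.continuous_fderiv two_ne_zero
  unfold strainedVorticityOperator
  exact ((hΔ.add ((continuous_const.mul (PiLp.continuous_apply 2 _ 0)).mul (hD.clm_apply continuous_const))).add
    ((continuous_const.mul (PiLp.continuous_apply 2 _ 1)).mul (hD.clm_apply continuous_const))).add hw.continuous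

/-- `v^G` is continuous. [folklore] -/
theorem continuous_gaussVortexVelocity : Continuous gaussVortexVelocity := by
  change Continuous fun ξ : EuclideanSpace ℝ (Fin 2) => ((8 * Real.pi)⁻¹ * burgersPhi (‖ξ‖ ^ 2 / 4)) • perp ξ
  exact (continuous_const.mul ((contDiff_burgersPhi (n := 0)).continuous.comp
    ((continuous_norm.pow 2).div_const _))).smul continuous_perp

/-- `‖v^G(ξ)‖ = (8π)⁻¹φ(|ξ|²/4)|ξ| ≤ |ξ| ≤ 1 + |ξ|` (`0 < φ ≤ 1` on `[0, ∞)`). [folklore] -/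
theorem norm_gaussVortexVelocity_le (ξ : EuclideanSpace ℝ (Fin 2)) : ‖gaussVortexVelocity ξ‖ ≤ 1 * (1 + ‖ξ‖) ^ 1 := by
  have hφ : burgersPhi (‖ξ‖ ^ 2 / 4) ≤ 1 := burgersPhi_le_one (by positivity)
  have hφ0 : 0 < burgersPhi (‖ξ‖ ^ 2 / 4) := burgersPhi_pos _
  have hc : (8 * Real.pi)⁻¹ ≤ 1 := inv_le_one_of_one_le₀ (by nlinarith [Real.pi_gt_three])
  have hc0 : 0 < (8 * Real.pi)⁻¹ := by positivity
  rw [gaussVortexVelocity, norm_smul, norm_perp, Real.norm_eq_abs, abs_of_pos (mul_pos hc0 hφ0), one_mul, pow_one]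
  have h1 : (8 * Real.pi)⁻¹ * burgersPhi (‖ξ‖ ^ 2 / 4) ≤ 1 := by nlinarith
  have h2 := mul_le_mul_of_nonneg_right h1 (norm_nonneg ξ)
  linarith [norm_nonneg ξ]

/-- `‖∇G(ξ)‖ ≤ (G(ξ)/2)|ξ| ≤ (1 + |ξ|) G(ξ)`. [folklore] -/
theorem norm_gradient_gaussVortexProfile_le (ξ : EuclideanSpace ℝ (Fin 2)) :
    ‖gradient gaussVortexProfile ξ‖ ≤ 1 * (1 + ‖ξ‖) ^ 1 * gaussVortexProfile ξ := by
  rw [norm_gradient_eq_norm_fderiv, one_mul, pow_one]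
  have hG := gaussVortexProfile_pos ξ
  refine (norm_fderiv_gaussVortexProfile_le ξ).trans ?_
  nlinarith [mul_nonneg hG.le (norm_nonneg ξ)]

/-- The linear strain field `Bξ = (b₁ξ₀ + b₂ξ₁, b₂ξ₀ − b₁ξ₁)` has `‖Bξ‖ = (b₁² + b₂²)^{1/2}|ξ|`. [folklore] -/
theorem norm_strainField_le (b₁ b₂ : ℝ) (ξ : EuclideanSpace ℝ (Fin 2)) :
    ‖(toLp 2 ![b₁ * ξ 0 + b₂ * ξ 1, b₂ * ξ 0 - b₁ * ξ 1] : EuclideanSpace ℝ (Fin 2))‖ ≤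
      Real.sqrt (b₁ ^ 2 + b₂ ^ 2) * (1 + ‖ξ‖) ^ 1 := by
  have hsq : ‖(toLp 2 ![b₁ * ξ 0 + b₂ * ξ 1, b₂ * ξ 0 - b₁ * ξ 1] : EuclideanSpace ℝ (Fin 2))‖ ^ 2 =
      (b₁ ^ 2 + b₂ ^ 2) * ‖ξ‖ ^ 2 := by
    rw [EuclideanSpace.real_norm_sq_eq, EuclideanSpace.real_norm_sq_eq ξ, Fin.sum_univ_two, Fin.sum_univ_two]
    simp only [Matrix.cons_val_zero, Matrix.cons_val_one]
    ring
  have h1 : ‖(toLp 2 ![b₁ * ξ 0 + b₂ * ξ 1, b₂ * ξ 0 - b₁ * ξ 1] : EuclideanSpace ℝ (Fin 2))‖ =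
      Real.sqrt (b₁ ^ 2 + b₂ ^ 2) * ‖ξ‖ := by
    rw [← Real.sqrt_sq (norm_nonneg _), hsq, Real.sqrt_mul (by positivity), Real.sqrt_sq (norm_nonneg _)]
  rw [h1, pow_one]
  exact mul_le_mul_of_nonneg_left (by linarith [norm_nonneg ξ]) (Real.sqrt_nonneg _)

/-- The linear strain field is continuous. [folklore] -/
theorem continuous_strainField (b₁ b₂ : ℝ) :
    Continuous fun ξ : EuclideanSpace ℝ (Fin 2) =>
      (toLp 2 ![b₁ * ξ 0 + b₂ * ξ 1, b₂ * ξ 0 - b₁ * ξ 1] : EuclideanSpace ℝ (Fin 2)) := by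
  refine (PiLp.continuous_toLp 2 _).comp (continuous_pi fun i => ?_)
  fin_cases i
  · exact ((continuous_const.mul (PiLp.continuous_apply 2 _ 0)).add
      (continuous_const.mul (PiLp.continuous_apply 2 _ 1)))
  · exact ((continuous_const.mul (PiLp.continuous_apply 2 _ 0)).sub
      (continuous_const.mul (PiLp.continuous_apply 2 _ 1)))

/-- The Biot–Savart velocity of a continuous density is a.e. strongly measurable. [folklore] -/
theorem aestronglyMeasurable_biotSavart2D {g : EuclideanSpace ℝ (Fin 2) → ℝ} (hg : Continuous g) :
    AEStronglyMeasurable (biotSavart2D g) volume :=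
  (stronglyMeasurable_biotSavart2D hg.measurable).aestronglyMeasurable

/-- **The Biot–Savart velocity of a continuous Gaussian-class density is bounded** (from the far-field bound
`‖K∗g‖ ≤ CA/(1+|ξ|)` of `…StubBiotSavartFarField`). [folklore] -/
theorem exists_norm_biotSavart2D_le_of_gaussClass {g : EuclideanSpace ℝ (Fin 2) → ℝ} (hg : Continuous g)
    {A : ℝ} {k : ℕ} (hgA : ∀ η, |g η| ≤ A * (1 + ‖η‖) ^ k * gaussVortexProfile η) :
    ∃ K : ℝ, ∀ ξ, ‖biotSavart2D g ξ‖ ≤ K * (1 + ‖ξ‖) ^ 0 := by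
  obtain ⟨C, hC, hfar⟩ := biotSavart2D_farField k
  have hA : 0 ≤ A := gaussClass_const_nonneg hgA
  refine ⟨C * A, fun ξ => ?_⟩
  rw [pow_zero, mul_one]
  exact ((hfar A g hg hgA ξ).1).trans (div_le_self (mul_nonneg hC.le hA) (by linarith [norm_nonneg ξ]))

/-! ### The composite pieces `Sw`, `Λ_B w` -/

/-- **The strain term is of Gaussian class**: with `χ, ∇χ` bounded, `‖V‖ ≤ C_V(1+|ξ|)`, `|w| ≤ C_wG`,
`‖∇w‖ ≤ C'_w(1+|ξ|)G`: `|χ⟪V, ∇w⟫ + ⟪∇χ, V⟫w| ≤ C(1+|ξ|)²G`. [folklore] -/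
theorem gaussClass_strainTerm {χ w : EuclideanSpace ℝ (Fin 2) → ℝ}
    {V : EuclideanSpace ℝ (Fin 2) → EuclideanSpace ℝ (Fin 2)} {Aχ CV Cw Cw' : ℝ}
    (hχ : ∀ ξ, |χ ξ| ≤ Aχ * (1 + ‖ξ‖) ^ 0) (hχ' : ∀ ξ, ‖gradient χ ξ‖ ≤ Aχ * (1 + ‖ξ‖) ^ 0)
    (hV : ∀ ξ, ‖V ξ‖ ≤ CV * (1 + ‖ξ‖) ^ 1)
    (hw : ∀ ξ, |w ξ| ≤ Cw * (1 + ‖ξ‖) ^ 0 * gaussVortexProfile ξ)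
    (hw' : ∀ ξ, ‖gradient w ξ‖ ≤ Cw' * (1 + ‖ξ‖) ^ 1 * gaussVortexProfile ξ) (ξ : EuclideanSpace ℝ (Fin 2)) :
    |χ ξ * ⟪V ξ, gradient w ξ⟫ + ⟪gradient χ ξ, V ξ⟫ * w ξ| ≤
      (Aχ * (CV * Cw') + Aχ * CV * Cw) * (1 + ‖ξ‖) ^ 2 * gaussVortexProfile ξ := by
  have h1 : ∀ ξ, |χ ξ * ⟪V ξ, gradient w ξ⟫| ≤ (Aχ * (CV * Cw')) * (1 + ‖ξ‖) ^ (0 + (1 + 1)) * gaussVortexProfile ξ :=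
    gaussClass_mul_left hχ (gaussClass_inner_left hV hw')
  have h2 : ∀ ξ, |⟪gradient χ ξ, V ξ⟫| ≤ (Aχ * CV) * (1 + ‖ξ‖) ^ 1 := fun ξ =>
    calc |⟪gradient χ ξ, V ξ⟫| ≤ ‖gradient χ ξ‖ * ‖V ξ‖ := abs_real_inner_le_norm _ _
      _ ≤ (Aχ * (1 + ‖ξ‖) ^ 0) * (CV * (1 + ‖ξ‖) ^ 1) :=
          mul_le_mul (hχ' ξ) (hV ξ) (norm_nonneg _) ((norm_nonneg _).trans (hχ' ξ))
      _ = (Aχ * CV) * (1 + ‖ξ‖) ^ 1 := by ring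
  have h3 : ∀ ξ, |⟪gradient χ ξ, V ξ⟫ * w ξ| ≤ (Aχ * CV * Cw) * (1 + ‖ξ‖) ^ (1 + 0) * gaussVortexProfile ξ :=
    gaussClass_mul_left h2 hw
  exact gaussClass_add (gaussClass_mono (m := 2) (by norm_num) h1) (gaussClass_mono (m := 2) (by norm_num) h3) ξ

/-- **The background term `Λ_B w = ⟪K∗w, ∇w_B⟫ + ⟪K∗w_B, ∇w⟫` is of Gaussian class** `(1+|ξ|)^{k+1}G` when
`K∗w`, `K∗w_B` are bounded, `‖∇w_B‖ ≤ C_B(1+|ξ|)^kG` and `‖∇w‖ ≤ C'_w(1+|ξ|)G`. [folklore] -/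
theorem gaussClass_backgroundTerm {w wB : EuclideanSpace ℝ (Fin 2) → ℝ} {Kw KB C_B Cw' : ℝ} {k : ℕ}
    (hKw : ∀ ξ, ‖biotSavart2D w ξ‖ ≤ Kw * (1 + ‖ξ‖) ^ 0) (hKB : ∀ ξ, ‖biotSavart2D wB ξ‖ ≤ KB * (1 + ‖ξ‖) ^ 0)
    (hwB' : ∀ ξ, ‖gradient wB ξ‖ ≤ C_B * (1 + ‖ξ‖) ^ k * gaussVortexProfile ξ)
    (hw' : ∀ ξ, ‖gradient w ξ‖ ≤ Cw' * (1 + ‖ξ‖) ^ 1 * gaussVortexProfile ξ) (ξ : EuclideanSpace ℝ (Fin 2)) :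
    |⟪biotSavart2D w ξ, gradient wB ξ⟫ + ⟪biotSavart2D wB ξ, gradient w ξ⟫| ≤
      (Kw * C_B + KB * Cw') * (1 + ‖ξ‖) ^ (k + 1) * gaussVortexProfile ξ :=
  gaussClass_add (gaussClass_mono (m := k + 1) (by omega) (gaussClass_inner_left hKw hwB'))
    (gaussClass_mono (m := k + 1) (by omega) (gaussClass_inner_left hKB hw')) ξ

/-! ### The registered helper: ground-state bounds -/

/-- **Registered helper `coreInverse_groundState_bounds`** toward `stub_coreInverse`: for `u ∈ C²(ℝ²)` with
`|u|, ‖Du‖, ‖D²u‖ ≤ M` and `w = G u`: `|w| ≤ MG`, `‖∇w‖ ≤ M(1+|ξ|)G`, `|∂_θw| ≤ M(1+|ξ|)G`, `|Lw| ≤ 3M(1+|ξ|)G`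
(`L = strainedVorticityOperator 0 = Δ + ½ξ·∇ + 1`). [folklore] -/
theorem coreInverse_groundState_bounds :
    ∀ (u : EuclideanSpace ℝ (Fin 2) → ℝ) (M : ℝ), ContDiff ℝ 2 u →
      (∀ ξ, |u ξ| ≤ M ∧ ‖fderiv ℝ u ξ‖ ≤ M ∧ ‖fderiv ℝ (fderiv ℝ u) ξ‖ ≤ M) →
      ∀ ξ, |gaussVortexProfile ξ * u ξ| ≤ M * gaussVortexProfile ξ ∧
        ‖gradient (fun η => gaussVortexProfile η * u η) ξ‖ ≤ M * (1 + ‖ξ‖) * gaussVortexProfile ξ ∧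
        |fderiv ℝ (fun η => gaussVortexProfile η * u η) ξ (perp ξ)| ≤ M * (1 + ‖ξ‖) * gaussVortexProfile ξ ∧
        |strainedVorticityOperator 0 (fun η => gaussVortexProfile η * u η) ξ| ≤
          3 * M * (1 + ‖ξ‖) * gaussVortexProfile ξ := by
  intro u M hu hM ξ
  have hud : Differentiable ℝ u := hu.differentiable two_ne_zero
  refine ⟨?_, ?_, ?_, ?_⟩
  · simpa using abs_gauss_mul_le_of_coreBound hM ξ
  · simpa using norm_gradient_gauss_mul_le_of_coreBound hM hud ξ
  · simpa using abs_angularDeriv_gauss_mul_le_of_coreBound hM hud ξ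
  · simpa using abs_strainedVorticityOperator_gauss_mul_le_of_coreBound hM hu ξ

end Summit.AnomalousDissipation.AnomalousDissipation.Theorems.MarginalStabilityChainStretchedVortexRows

end
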